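import Literature.MathematicalPhysics.KineticTheory.LangevinChainExpBound
import Literature.MathematicalPhysics.KineticTheory.LangevinChainConfined

/-!
# The reversed generator of the Langevin chain on functions of the energy

Helper file for item stmt-AtomisticToContinuum-9144 (`ResponseDensity`, route
`OddSectorIrreversibility`, sub-problem `FouriersLaw` of `AtomisticToContinuum`).

The generator `L̂ f = Df·(-Y) + ½ ∑_b D²f[v_b, v_b]` of the momentum-reversed Langevin drift `-Y`
(the first-variable operator of the backward equation of `LangevinChainReversal.lean`; `L̂ + 2γ = Lᵀ`
is the formal transpose of the generator `L`) applied to a function of the energy of an oscillator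
chain: `L̂(F∘H) = γ ∑_b (T_b (F''(H) p_b² + F'(H)) + F'(H) p_b²)` — the Hamiltonian part of `Y`
conserves `H` and reversing the friction turns `-γ p_b ∂_{p_b}` into `+γ p_b ∂_{p_b}` — together
with the resulting bound when `F', F''` are exponentially dominated. No definitions.
-/

noncomputable section

open MeasureTheory Filter Topology Set
open scoped ContDiff

namespace Summit.AtomisticToContinuum.FouriersLaw.Theorems

open Literature.MathematicalPhysics.KineticTheory.HeatConduction
open Literature.MathematicalPhysics.KineticTheory

/-! ### The reversed generator of a function of the energy -/

section ReversedGenerator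

variable (P : OscillatorChain) {N : ℕ}

/-- **The generator of the momentum-reversed Langevin drift on a function of the energy**
(indicator-sum form): with `L̂ f = Df·(-Y) + ½ ∑_b D²f[v_b, v_b]` the first-variable operator of the
backward equation (`L̂ + 2γ = Lᵀ`),
`L̂(F∘H) = γ ∑_i ([i=0](T_L (F''(H) p_i² + F'(H)) + F'(H) p_i²) + [i=N-1](T_R (…) + F'(H) p_i²))`:
the Hamiltonian part of `Y` conserves `H`, reversing the friction turns `-γ p_b ∂_{p_b}` into
`+γ p_b ∂_{p_b}`. -/
theorem sdeGenerator_negDrift_comp_hamiltonian_sum (hN : 0 < N) {T_L T_R : ℝ}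
    (hL : 0 ≤ P.γ * T_L) (hR : 0 ≤ P.γ * T_R) (hH : ContDiff ℝ 2 (P.hamiltonian N))
    {F F' F'' : ℝ → ℝ} (hFc : ContDiff ℝ 2 F) (hF : ∀ u, HasDerivAt F (F' u) u)
    (hF' : ∀ u, HasDerivAt F' (F'' u) u) (x : PhaseSpace N) :
    sdeGenerator (fun y => -P.drift N y) (P.bathVecL N T_L) (P.bathVecR N T_R)
        (fun y => F (P.hamiltonian N y)) x =
      P.γ * ∑ i : Fin N,
        ((if i.val = 0 then T_L * (F'' (P.hamiltonian N x) * x.2 i ^ 2 + F' (P.hamiltonian N x)) +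
            F' (P.hamiltonian N x) * x.2 i ^ 2 else 0) +
          (if i.val = N - 1 then
            T_R * (F'' (P.hamiltonian N x) * x.2 i ^ 2 + F' (P.hamiltonian N x)) +
              F' (P.hamiltonian N x) * x.2 i ^ 2 else 0)) := by
  set H := P.hamiltonian N with hHdef
  have hHd : Differentiable ℝ H := hH.differentiable (by norm_num)
  have hf2 : ContDiff ℝ 2 (fun y => F (H y)) := hFc.comp hH
  -- reversing the drift: `L̂ f = L f - 2 Df·Y`
  have h1 : sdeGenerator (fun y => -P.drift N y) (P.bathVecL N T_L) (P.bathVecR N T_R)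
        (fun y => F (H y)) x =
      sdeGenerator (P.drift N) (P.bathVecL N T_L) (P.bathVecR N T_R) (fun y => F (H y)) x -
        2 * fderiv ℝ (fun y => F (H y)) x (P.drift N x) := by
    simp only [sdeGenerator_def, map_neg]
    ring
  -- chain rule
  have h2 : fderiv ℝ (fun y => F (H y)) x (P.drift N x) =
      F' (H x) * fderiv ℝ H x (P.drift N x) := by
    have hc : HasFDerivAt (fun y => F (H y)) (F' (H x) • fderiv ℝ H x) x :=
      (hF (H x)).comp_hasFDerivAt x (hHd x).hasFDerivAt
    rw [hc.fderiv]
    rfl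
  -- the energy identity with zero forcing: `DH·Y = -γ ∑_b p_b²`
  have h3 : fderiv ℝ H x (P.drift N x) =
      ∑ i, (-(P.γ * OscillatorChain.bathWeight N i * x.2 i ^ 2)) := by
    have h := P.fderiv_hamiltonian_drift_eq_sum hHd x 0
    have hx : ((x.1, x.2 + 0) : PhaseSpace N) = x := by simp
    rw [hx] at h
    rw [h]
    exact Finset.sum_congr rfl fun i _ => by simp
  rw [h1, P.sdeGenerator_drift_eq_generator hN hL hR hf2, P.generator_comp_hamiltonian hHd hF hF',
    h2, h3]
  have e3 : (2 : ℝ) * (F' (H x) * ∑ i : Fin N, -(P.γ * OscillatorChain.bathWeight N i * x.2 i ^ 2)) =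
      P.γ * ∑ i : Fin N, (-(2 * F' (H x) * OscillatorChain.bathWeight N i * x.2 i ^ 2)) := by
    rw [Finset.mul_sum Finset.univ _ (P.γ), Finset.mul_sum Finset.univ _ (F' (H x)),
      Finset.mul_sum Finset.univ _ (2 : ℝ)]
    exact Finset.sum_congr rfl fun i _ => by ring
  rw [e3, ← mul_sub, ← Finset.sum_sub_distrib]
  congr 1
  refine Finset.sum_congr rfl fun i _ => ?_
  unfold OscillatorChain.bathWeight
  split_ifs <;> ring

/-- **The reversed generator on a function of the energy, closed form** (`N ≥ 1`; for `N = 1` both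
baths sit on the single site and the two terms coincide):
`L̂(F∘H) = γ (T_L (F''(H) p_0² + F'(H)) + F'(H) p_0² + T_R (F''(H) p_{N-1}² + F'(H)) + F'(H) p_{N-1}²)`. -/
theorem sdeGenerator_negDrift_comp_hamiltonian (hN : 0 < N) {T_L T_R : ℝ}
    (hL : 0 ≤ P.γ * T_L) (hR : 0 ≤ P.γ * T_R) (hH : ContDiff ℝ 2 (P.hamiltonian N))
    {F F' F'' : ℝ → ℝ} (hFc : ContDiff ℝ 2 F) (hF : ∀ u, HasDerivAt F (F' u) u)
    (hF' : ∀ u, HasDerivAt F' (F'' u) u) (x : PhaseSpace N) :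
    sdeGenerator (fun y => -P.drift N y) (P.bathVecL N T_L) (P.bathVecR N T_R)
        (fun y => F (P.hamiltonian N y)) x =
      P.γ * ((T_L * (F'' (P.hamiltonian N x) * x.2 ⟨0, hN⟩ ^ 2 + F' (P.hamiltonian N x)) +
          F' (P.hamiltonian N x) * x.2 ⟨0, hN⟩ ^ 2) +
        (T_R * (F'' (P.hamiltonian N x) * x.2 ⟨N - 1, by omega⟩ ^ 2 + F' (P.hamiltonian N x)) +
          F' (P.hamiltonian N x) * x.2 ⟨N - 1, by omega⟩ ^ 2)) := by
  rw [sdeGenerator_negDrift_comp_hamiltonian_sum P hN hL hR hH hFc hF hF' x, Finset.sum_add_distrib]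
  congr 1
  have e1 : ∑ i : Fin N, (if i.val = 0 then
      T_L * (F'' (P.hamiltonian N x) * x.2 i ^ 2 + F' (P.hamiltonian N x)) +
        F' (P.hamiltonian N x) * x.2 i ^ 2 else 0) =
      T_L * (F'' (P.hamiltonian N x) * x.2 ⟨0, hN⟩ ^ 2 + F' (P.hamiltonian N x)) +
        F' (P.hamiltonian N x) * x.2 ⟨0, hN⟩ ^ 2 := by
    rw [Finset.sum_eq_single_of_mem (⟨0, hN⟩ : Fin N) (Finset.mem_univ _)]
    · simp
    · intro j _ hj
      rw [if_neg]
      exact fun h => hj (Fin.ext h)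
  have e2 : ∑ i : Fin N, (if i.val = N - 1 then
      T_R * (F'' (P.hamiltonian N x) * x.2 i ^ 2 + F' (P.hamiltonian N x)) +
        F' (P.hamiltonian N x) * x.2 i ^ 2 else 0) =
      T_R * (F'' (P.hamiltonian N x) * x.2 ⟨N - 1, by omega⟩ ^ 2 + F' (P.hamiltonian N x)) +
        F' (P.hamiltonian N x) * x.2 ⟨N - 1, by omega⟩ ^ 2 := by
    rw [Finset.sum_eq_single_of_mem (⟨N - 1, by omega⟩ : Fin N) (Finset.mem_univ _)]
    · simp
    · intro j _ hj
      rw [if_neg]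
      exact fun h => hj (Fin.ext h)
  rw [e1, e2]

/-- **Exponential bound of the reversed generator on a function of the energy.** If
`|F'(H(x))| ≤ A₁ E` and `|F''(H(x))| ≤ A₂ E` (`γ, T_L, T_R ≥ 0`), then
`|L̂(F∘H)(x)| ≤ γ (A₁ + A₂) (T_L + T_R + 2) (1 + p_0² + p_{N-1}²) E`. -/
theorem abs_sdeGenerator_negDrift_comp_hamiltonian_le (hN : 0 < N) (hγ : 0 ≤ P.γ) {T_L T_R : ℝ}
    (hTL : 0 ≤ T_L) (hTR : 0 ≤ T_R) (hH : ContDiff ℝ 2 (P.hamiltonian N))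
    {F F' F'' : ℝ → ℝ} (hFc : ContDiff ℝ 2 F) (hF : ∀ u, HasDerivAt F (F' u) u)
    (hF' : ∀ u, HasDerivAt F' (F'' u) u) (x : PhaseSpace N) {A₁ A₂ E : ℝ}
    (h1 : |F' (P.hamiltonian N x)| ≤ A₁ * E) (h2 : |F'' (P.hamiltonian N x)| ≤ A₂ * E) :
    |sdeGenerator (fun y => -P.drift N y) (P.bathVecL N T_L) (P.bathVecR N T_R)
        (fun y => F (P.hamiltonian N y)) x| ≤
      P.γ * ((A₁ + A₂) * (T_L + T_R + 2) *
        (1 + x.2 ⟨0, hN⟩ ^ 2 + x.2 ⟨N - 1, by omega⟩ ^ 2) * E) := by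
  rw [sdeGenerator_negDrift_comp_hamiltonian P hN (mul_nonneg hγ hTL) (mul_nonneg hγ hTR) hH hFc
    hF hF' x, abs_mul, abs_of_nonneg hγ]
  refine mul_le_mul_of_nonneg_left ?_ hγ
  set b := F' (P.hamiltonian N x)
  set c := F'' (P.hamiltonian N x)
  set p := x.2 ⟨0, hN⟩
  set q := x.2 ⟨N - 1, by omega⟩
  have hA₁ : 0 ≤ A₁ * E := (abs_nonneg _).trans h1
  have hA₂ : 0 ≤ A₂ * E := (abs_nonneg _).trans h2
  have hp : 0 ≤ p ^ 2 := sq_nonneg p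
  have hq : 0 ≤ q ^ 2 := sq_nonneg q
  -- one bath term
  have hterm : ∀ (T : ℝ), 0 ≤ T → ∀ (r : ℝ),
      |T * (c * r ^ 2 + b) + b * r ^ 2| ≤ (A₁ * E + A₂ * E) * (T + 1) * (1 + r ^ 2) := by
    intro T hT r
    have hr : 0 ≤ r ^ 2 := sq_nonneg r
    have hb : |b| ≤ A₁ * E := h1
    have hc : |c| ≤ A₂ * E := h2
    calc |T * (c * r ^ 2 + b) + b * r ^ 2|
        ≤ |T * (c * r ^ 2 + b)| + |b * r ^ 2| := abs_add_le _ _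
      _ = T * |c * r ^ 2 + b| + |b| * r ^ 2 := by
          rw [abs_mul, abs_of_nonneg hT, abs_mul, abs_of_nonneg hr]
      _ ≤ T * (|c| * r ^ 2 + |b|) + |b| * r ^ 2 := by
          refine add_le_add (mul_le_mul_of_nonneg_left ?_ hT) le_rfl
          calc |c * r ^ 2 + b| ≤ |c * r ^ 2| + |b| := abs_add_le _ _
            _ = |c| * r ^ 2 + |b| := by rw [abs_mul, abs_of_nonneg hr]
      _ ≤ T * (A₂ * E * r ^ 2 + A₁ * E) + A₁ * E * r ^ 2 := by
          refine add_le_add (mul_le_mul_of_nonneg_left (add_le_add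
            (mul_le_mul_of_nonneg_right hc hr) hb) hT) (mul_le_mul_of_nonneg_right hb hr)
      _ ≤ (A₁ * E + A₂ * E) * (T + 1) * (1 + r ^ 2) := by
          nlinarith [mul_nonneg hA₁ hr, mul_nonneg hA₂ hr, mul_nonneg hT hr,
            mul_nonneg (mul_nonneg hT hr) hA₁, mul_nonneg (mul_nonneg hT hr) hA₂,
            mul_nonneg hT hA₁, mul_nonneg hT hA₂]
  have hL' := hterm T_L hTL p
  have hR' := hterm T_R hTR q
  calc |T_L * (c * p ^ 2 + b) + b * p ^ 2 + (T_R * (c * q ^ 2 + b) + b * q ^ 2)|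
      ≤ |T_L * (c * p ^ 2 + b) + b * p ^ 2| + |T_R * (c * q ^ 2 + b) + b * q ^ 2| := abs_add_le _ _
    _ ≤ (A₁ * E + A₂ * E) * (T_L + 1) * (1 + p ^ 2) + (A₁ * E + A₂ * E) * (T_R + 1) * (1 + q ^ 2) :=
        add_le_add hL' hR'
    _ ≤ (A₁ + A₂) * (T_L + T_R + 2) * (1 + p ^ 2 + q ^ 2) * E := by
        have hAE : 0 ≤ A₁ * E + A₂ * E := add_nonneg hA₁ hA₂
        nlinarith [mul_nonneg hAE hp, mul_nonneg hAE hq, mul_nonneg (mul_nonneg hAE hTL) hq,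
          mul_nonneg (mul_nonneg hAE hTR) hp, mul_nonneg hAE hTL, mul_nonneg hAE hTR]

end ReversedGenerator

end Summit.AtomisticToContinuum.FouriersLaw.Theorems

end
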